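import Summits.CriticalPhenomena.PercolationContinuityZ3.Theorems.PercNearOneGluingNoHeavyLowerTailSahiSlotPinnedCert
import Summits.CriticalPhenomena.PercolationContinuityZ3.Theorems.PercNearOneGluingNoHeavyLowerTailSahiSlotPairCert
import Summits.CriticalPhenomena.PercolationContinuityZ3.Theorems.PercNearOneGluingNoHeavyLowerTailSahiSlotPatternTwo

/-!
# The order-2 row of the tensor-cone table in EVERY dimension: `LitProdCert d 2` — the coefficientwise Harris form on the
# Boolean cube has an explicit literal-product ("pivotal-pair") certificate with 0/1 weights

Support file of the one-cut programme (crux `NoHeavyLowerTail`, stmt-CriticalPhenomena-4575; cell `prim-masterthm`, seat P3, gen 22;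
`run/shared/lean/prim/prim-masterthm/prim-masterthm-p3/HIERARCHY.md` §30, memo `FROM-prim-masterthm-p3-g22-*.md`).  Pure proofs, no new
definitions, standard axioms.

CONTEXT.  `SahiSlot.LitProdCert d n` (…SahiSlotTensorCone, gen 20) says that the slot functional `patternForm d n` is, on families of up-sets of
the slot cube `[n]^d`, a NONNEGATIVE combination of products of one monotonicity literal per member (`SahiSlot.Lit`: `x_⊥`, `1 − x_⊤`, cut edges
`x_{p+e_a} − x_p`).  The tree decides the order-3 row (`litProdCert_three_iff : LitProdCert d 3 ↔ d ≤ 2`) and has the order-2 POSITIVITY in every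
dimension (`slotPatternPos_two`, via Harris twice).  At order 2 the slot cube is the Boolean cube `[2]^d`, and the pattern functional is the
coefficientwise Harris / reflected-Kleitman form `patternForm d 2 h = Σ_p h₀(p)·(h₁(p) − h₁(p̄))` (`patternForm_two_eq_sum`, `p̄` the antipode).

THIS FILE: **`litProdCert_two : ∀ d, LitProdCert d 2`** — the order-2 row of the tensor-cone table holds in EVERY dimension, with an EXPLICIT
certificate using cut edges only and weights `0/1`:
  `Σ_p y(p)(z(p) − z(p̄)) = Σ_{(a, ω)} (y(ω + e_a) − y(ω)) · (z(ω' + e_a) − z(ω'))`,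
summed over the directions `a` and the base points `ω` with `ω_a = 0`, where `ω'` is `ω` REFLECTED IN THE COORDINATES BEFORE `a` (and equal to
`ω` after `a`) — `harrisForm_eq_sum_coverPairs` states it with an abstract finite index set built by the recursion
`cert_{d+1} = (cert_d in each of the two layers of the last coordinate) + Σ_p v_p ⊗ v_{p̄}` (`v_p` = the cut edge of the last coordinate over
`p ∈ [2]^d`), i.e. `I − R = (I_d − R_d) ⊗ I₂ + R_d ⊗ (I₂ − R₂)`.  Averaging this certificate over the `d!` orders of the coordinates gives the
symmetric closed form of the gen-20 memo (§2): parallel cut edges at Hamming distance `h` off their direction get weight `1/(d·C(d−1,h))` —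
the resampling-semigroup certificate of `Cov`; that remark is not used here.
CONSEQUENCES (all immediate from tree lemmas): `exists_litPairs_two` (the same identity with the tree's literals `SahiSlot.Lit`),
`pinnedLitCert_one : ∀ d, PinnedLitCert d 1` and `pairLitCert_zero : ∀ d, PairLitCert d 0` — the order-2 rows of the pinned / pivotal-pair
formats of gen 21 (…SahiSlotPinnedCert, …SahiSlotPairCert) are theorems in every dimension (and `slotPatternPos_of_litProdCert (litProdCert_two d)`
is a second proof of the tree's `slotPatternPos_two`); with `litProdCert_three_iff` the tensor-cone table now reads: row `n = 2` TRUE for all `d`,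
row `n = 3` TRUE iff `d ≤ 2`.
HONEST LABEL: a certificate-FORMAT theorem at order 2 (where positivity is Harris's inequality); it says nothing about any open cell
(`(3,5)`, `(4,4)`, `(d ≥ 4, 3)` in the kernel), nor about the pivotal-pair conjecture at order 3. [this work]
-/

noncomputable section

namespace Summit.CriticalPhenomena.PercolationContinuityZ3.Theorems

open Finset Function
open Literature.Combinatorics.Sahi2008

namespace SahiSlot

section OrderTwo

variable {d : ℕ}

/-- Splitting a sum over the Boolean cube `[2]^{d+1}` along the last coordinate. [this work] -/
theorem sum_cube_succ (f : Q (d + 1) 2 → ℝ) : ∑ q, f q = ∑ j : Fin 2, ∑ p : Q d 2, f (Fin.snoc p j) := by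
  rw [← (Fin.snocEquiv fun _ : Fin (d + 1) => Fin 2).sum_comp, Fintype.sum_prod_type]
  rfl

/-- The antipode of a `snoc` point. [this work] -/
theorem antipode_snoc (p : Q d 2) (j : Fin 2) :
    antipode (Fin.snoc p j : Q (d + 1) 2) = Fin.snoc (antipode p) (Fin.rev j) := by
  funext b
  refine Fin.lastCases ?_ (fun i => ?_) b
  · simp only [antipode, Fin.snoc_last]
  · simp only [antipode, Fin.snoc_castSucc]

/-- **The explicit cover-pair certificate of the coefficientwise Harris form, every dimension.**  There is a finite family of triples
`(ω_t, ω'_t, a_t)` (base points with `ω_t(a_t) = ω'_t(a_t) = 0` and a common direction `a_t`) such that, for ALL `y, z : [2]^d → ℝ`,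
`Σ_p y(p)(z(p) − z(p̄)) = Σ_t (y(ω_t + e_{a_t}) − y(ω_t)) · (z(ω'_t + e_{a_t}) − z(ω'_t))` — an identity of bilinear forms with all weights `1`.
(Recursion on `d`: the two layers of the last coordinate carry a copy of the `d`-dimensional family; the last direction contributes the pairs
`(p, p̄)` of antipodal base points.) [this work] -/
theorem harrisForm_eq_sum_coverPairs (d : ℕ) :
    ∃ (ι : Type) (_ : Fintype ι) (ω ω' : ι → Q d 2) (a : ι → Fin d),
      (∀ t, ω t (a t) = 0) ∧ (∀ t, ω' t (a t) = 0) ∧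
      ∀ y z : Q d 2 → ℝ, ∑ p, y p * (z p - z (antipode p)) =
        ∑ t, (y (update (ω t) (a t) 1) - y (ω t)) * (z (update (ω' t) (a t) 1) - z (ω' t)) := by
  induction d with
  | zero =>
    refine ⟨Empty, inferInstance, Empty.elim, Empty.elim, Empty.elim, fun t => t.elim, fun t => t.elim, fun y z => ?_⟩
    have h : ∀ p : Q 0 2, antipode p = p := fun p => Subsingleton.elim _ _
    simp [h]
  | succ d ih =>
    obtain ⟨ι, hι, ω, ω', a, h1, h2, hid⟩ := ih
    refine ⟨(ι × Fin 2) ⊕ Q d 2, inferInstance,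
      Sum.elim (fun tj => Fin.snoc (ω tj.1) tj.2) (fun p => Fin.snoc p 0),
      Sum.elim (fun tj => Fin.snoc (ω' tj.1) tj.2) (fun p => Fin.snoc (antipode p) 0),
      Sum.elim (fun tj => Fin.castSucc (a tj.1)) (fun _ => Fin.last d), ?_, ?_, fun y z => ?_⟩
    · rintro (⟨t, j⟩ | p)
      · simp only [Sum.elim_inl, Fin.snoc_castSucc]; exact h1 t
      · simp only [Sum.elim_inr, Fin.snoc_last]
    · rintro (⟨t, j⟩ | p)
      · simp only [Sum.elim_inl, Fin.snoc_castSucc]; exact h2 t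
      · simp only [Sum.elim_inr, Fin.snoc_last]
    · -- left-hand side, split along the last coordinate
      rw [sum_cube_succ, Fintype.sum_sum_type, Fintype.sum_prod_type]
      simp only [Sum.elim_inl, Sum.elim_inr, ← Fin.snoc_update, Fin.update_snoc_last, antipode_snoc]
      -- the two layers: induction hypothesis
      have hlayer : ∀ j : Fin 2,
          ∑ t, (y (Fin.snoc (update (ω t) (a t) 1) j) - y (Fin.snoc (ω t) j)) *
              (z (Fin.snoc (update (ω' t) (a t) 1) j) - z (Fin.snoc (ω' t) j)) =
            ∑ p : Q d 2, y (Fin.snoc p j) * (z (Fin.snoc p j) - z (Fin.snoc (antipode p) j)) :=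
        fun j => (hid (fun p => y (Fin.snoc p j)) (fun p => z (Fin.snoc p j))).symm
      have hswap : (∑ t, ∑ j : Fin 2, (y (Fin.snoc (update (ω t) (a t) 1) j) - y (Fin.snoc (ω t) j)) *
              (z (Fin.snoc (update (ω' t) (a t) 1) j) - z (Fin.snoc (ω' t) j))) =
            ∑ j : Fin 2, ∑ p : Q d 2, y (Fin.snoc p j) * (z (Fin.snoc p j) - z (Fin.snoc (antipode p) j)) := by
        rw [Finset.sum_comm]
        exact Finset.sum_congr rfl fun j _ => hlayer j
      rw [hswap]
      have r0 : Fin.rev (0 : Fin 2) = 1 := by decide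
      have r1 : Fin.rev (1 : Fin 2) = 0 := by decide
      rw [Fin.sum_univ_two, Fin.sum_univ_two, r0, r1, ← Finset.sum_add_distrib, ← Finset.sum_add_distrib,
        ← Finset.sum_add_distrib]
      refine Finset.sum_congr rfl fun p _ => ?_
      ring

/-- Evaluation of a genuine cut edge of the Boolean cube (base coordinate `0`). [this work] -/
theorem Lit.eval_cover_of_eq_zero (p : Q d 2) (b : Fin d) (hp : p b = 0) (x : Q d 2 → ℝ) :
    (Lit.cover p b : Lit d 2).eval x = x (update p b 1) - x p := by
  show (if h : (p b : ℕ) + 1 < 2 then x (update p b ⟨(p b : ℕ) + 1, h⟩) - x p else 0) = x (update p b 1) - x p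
  have hpb : (p b : ℕ) = 0 := by rw [hp]; rfl
  have hlt : (p b : ℕ) + 1 < 2 := by rw [hpb]; decide
  have hone : (⟨(p b : ℕ) + 1, hlt⟩ : Fin 2) = 1 := Fin.ext (by show (p b : ℕ) + 1 = 1; rw [hpb])
  rw [dif_pos hlt, hone]

/-- **The coefficientwise Harris form as a sum of products of PAIRS OF LITERALS** (cut edges only, all weights `1`), every dimension:
finitely many literal pairs `(J_t, J'_t)` with `Σ_p y(p)(z(p) − z(p̄)) = Σ_t J_t(y)·J'_t(z)` for all `y, z`. [this work] -/
theorem exists_litPairs_two (d : ℕ) : ∃ (k : ℕ) (J J' : Fin k → Lit d 2), ∀ y z : Q d 2 → ℝ,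
    ∑ p, y p * (z p - z (antipode p)) = ∑ t, (J t).eval y * (J' t).eval z := by
  obtain ⟨ι, hι, ω, ω', a, h1, h2, hid⟩ := harrisForm_eq_sum_coverPairs d
  classical
  let e : ι ≃ Fin (Fintype.card ι) := Fintype.equivFin ι
  refine ⟨Fintype.card ι, fun t => Lit.cover (ω (e.symm t)) (a (e.symm t)), fun t => Lit.cover (ω' (e.symm t)) (a (e.symm t)),
    fun y z => ?_⟩
  rw [hid y z, ← e.symm.sum_comp]
  refine Fintype.sum_congr _ _ fun t => ?_
  rw [Lit.eval_cover_of_eq_zero _ _ (h1 _), Lit.eval_cover_of_eq_zero _ _ (h2 _)]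

/-- **`LitProdCert d 2` for EVERY `d`**: the order-2 slot functional (coefficientwise Harris on `[2]^d`) is a nonnegative — indeed `0/1` —
combination of products of one cut-edge literal per member. [this work] -/
theorem litProdCert_two (d : ℕ) : LitProdCert d 2 := by
  obtain ⟨k, J, J', hid⟩ := exists_litPairs_two d
  refine ⟨k, fun _ => 1, fun t i => if i = 0 then J t else J' t, fun _ => zero_le_one, fun U _ => ?_⟩
  rw [patternForm_two_eq_sum, hid (setInd (U 0)) (setInd (U 1))]
  refine Fintype.sum_congr _ _ fun t => ?_
  rw [one_mul, Fin.prod_univ_two]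
  simp only [if_true, one_ne_zero, if_false]

/-- **The order-2 row of the tensor-cone table, complete**: `LitProdCert d 2` holds for every `d` — compare `litProdCert_three_iff :
LitProdCert d 3 ↔ d ≤ 2` one row up. [this work] -/
theorem litProdCert_two_iff_true (d : ℕ) : LitProdCert d 2 ↔ True := iff_true_intro (litProdCert_two d)

/-- **`PinnedLitCert d 1` for every `d`** (order 2 with one member pinned — the `n = 1` row of the pinned format). [this work] -/
theorem pinnedLitCert_one (d : ℕ) : PinnedLitCert d 1 := pinnedLitCert_of_litProdCert (litProdCert_two d)

/-- **`PairLitCert d 0` for every `d`**: the `n = 0` row of the pivotal-pair conjecture (order 2, nothing pinned) is a theorem in every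
dimension — the literal pairs of `exists_litPairs_two`. [this work] -/
theorem pairLitCert_zero (d : ℕ) : PairLitCert d 0 := by
  intro A _
  obtain ⟨k, J, J', hid⟩ := exists_litPairs_two d
  refine ⟨k, fun _ => 1, J, J', fun _ => zero_le_one, fun B C _ _ => ?_⟩
  rw [patternForm_two_eq_sum]
  have h0 : pairFam (fun i => setInd (A i)) (setInd B) (setInd C) 0 = setInd B := rfl
  have h1 : pairFam (fun i => setInd (A i)) (setInd B) (setInd C) 1 = setInd C := rfl
  rw [h0, h1, hid (setInd B) (setInd C)]
  exact Fintype.sum_congr _ _ fun t => (one_mul _).symm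

end OrderTwo

end SahiSlot

end Summit.CriticalPhenomena.PercolationContinuityZ3.Theorems
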